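import Mathlib
import Summits.Ventures.HodgeRepro.Tier4.Line1.RTFSetting
import Summits.Ventures.HodgeRepro.Tier4.Line1.KernelNondegenerate
import Summits.Ventures.HodgeRepro.Tier4.Line1.IrreducibleSubspace
import Summits.Ventures.HodgeRepro.Tier4.Line1.AdaptedONBGlue

/-!
# Tier4/Line1/AdaptedONB — the adapted ONB, unconditional modulo `hinf`

Blind re-derivation cell `pub-hodge-repro`, Tier 4 «prove the step» (README §9–§10), seat t4-L4-p1 (cross-line J1 glue,
lead S12599).  Tree path `lean/Summits/Ventures/HodgeRepro/Tier4/Line1/AdaptedONB.lean`.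

`exists_adaptedONB`: the J1 glue `exists_adaptedONB_of_rungs` with rung (4b) discharged BY NAME — p4's
`exists_irreducible_invariant_subspace_of_nondegenerate` composed with the landed (4a) `kernelOp_nondegenerate`.
Only `hinf` («`L²(DG)` is not finite-dimensional») stays displayed.

HC_CM is NOT proved by anyone in this repository.
-/

set_option autoImplicit false

noncomputable section

namespace Summit.Ventures.HodgeRepro.Tier4.Line1

open MeasureTheory

namespace RTF

variable {G : Type} [Group G] [TopologicalSpace G] [IsTopologicalGroup G] [MeasurableSpace G]
  [BorelSpace G]

namespace Setting

variable (S : Setting G)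

/-- **The adapted ONB exists** for every `S : Setting G` over a second-countable locally compact `G` whose `L²(DG)` is
not finite-dimensional: (4b) by name, the glue by name. -/
theorem exists_adaptedONB [SecondCountableTopology G] [LocallyCompactSpace G]
    (hinf : ¬ FiniteDimensional ℂ (Lp ℂ 2 (S.μ.restrict S.DG))) :
    ∃ (τ : ℕ → Set (G → ℂ)) (φ : ℕ → G → ℂ) (n : ℕ → ℕ), S.IsAdaptedONB τ φ n :=
  S.exists_adaptedONB_of_rungs hinf fun V hV hclosed hne =>
    S.exists_irreducible_invariant_subspace_of_nondegenerate V hV hclosed hne S.kernelOp_nondegenerate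

end Setting

end RTF

end Summit.Ventures.HodgeRepro.Tier4.Line1

end
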